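import Literature.AlgebraicGeometry.Resolution.MarkedIdealsLemmas
import Mathlib.AlgebraicGeometry.Morphisms.Flat
import Mathlib.AlgebraicGeometry.Stalk
import Mathlib.RingTheory.Localization.BaseChange
import Mathlib.RingTheory.Localization.Ideal
import HarnessLib

/-!
# Extending ideal sheaves from the pro-open subscheme `X' ×_X Spec 𝒪_{X,x}` (Temkin Lemma 2.1.1)

Topic: `Literature/AlgebraicGeometry/Resolution`. A step in the decomposition of the named fact
`Temkin2008_prop234` (`Temkin2008Localization.lean`, Temkin 2008 Prop. 2.3.4: localization of
desingularization). In the Noetherian induction proving Prop. 2.3.4 (arXiv p. 12) the centre `𝓘`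
of a local desingularization lives on the pro-open pro-subscheme `S' = Spec 𝒪_{X,x} ×_X X'` of
`X'` and has to be extended to an ideal `𝓙 ⊂ 𝒪_{X'}` "supported on the Zariski closure of
`T'`" — Temkin's **Lemma 2.1.1** (p. 6): "assume that we are given an ideal `𝓘_S ⊂ 𝒪_S`. Let
`Z_S` denote the support of `𝓘_S` and `Z` be its Zariski closure in `X`. Then there exists an
ideal `𝓘 ⊂ 𝒪_X` such that `𝓘|_S = 𝓘_S` and the support of `𝓘` is `Z`", stated there for a
pro-open pro-subscheme `S = lim S_α` of a Noetherian scheme, "a typical example" being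
`Spec 𝒪_x`, "another example is obtained from this one by base change with respect to a
morphism `X' → X`".

We PROVE the lemma for these examples, i.e. for `j : X' ×_X Spec 𝒪_{X,x} ⟶ X'` (any `X'`, `X`,
`π : X' ⟶ X`; Noetherianity enters only through quasi-compactness of `j`, needed to speak of
the closure of the image), with the *largest* extension in place of Temkin's corrected
arbitrary one: `𝓙 = j_* 𝓘 ∩ 𝒪_{X'}` (Mathlib's `IdealSheafData.map`, the kernel of
`V(𝓘) ⟶ S' ⟶ X'`), whose support is automatically the closure of `j(V(𝓘))`
(`IdealSheafData.support_map`). The content is `j⁻¹𝓙 · 𝒪_{S'} = 𝓘`, i.e. every ideal on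
`S'` is extended from `X'`: affine-locally `S'` is `Spec (B ⊗_A A_𝔭) = Spec B_𝔭` over an
affine open `Spec B ⊆ X'` lying over an affine neighbourhood `Spec A` of `x = 𝔭` (Mathlib:
sections of fibre products of affine opens are pushouts, `isIso_pushoutSection_of_isAffineOpen`),
and every ideal of a localization is the extension of its contraction.

## Content (namespace `Literature.AlgGeom`), all PROVED

* `preimage_fromSpecStalk_eq_top`, `appLE_fromSpecStalk_top`,
  `isLocalization_sections_Spec_stalk` — `Γ(Spec 𝒪_{X,x}, ⊤)` is the localization of `Γ(X, V)`
  at `x` along `(Spec 𝒪_{X,x} ⟶ X)^♯`, for an affine open `V ∋ x`.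
* `pullback_fst_mem_preimage`, `isAffineOpen_preimage_pullback_fst` — for an affine open
  `W ⊆ π⁻¹(V)` of `X'`, `j⁻¹(W) = W ×_V Spec 𝒪_{X,x}` is affine, and these cover `S'`.
* `ideal_preimage_le_comap_map_pullback_fst` — on such a chart, `Γ(S', j⁻¹ W)` is the
  localization of `Γ(X', W)` at (the image of) `Γ(X, V) ∖ 𝔭_x` along `j^♯` (the square of
  sections is a pushout), so `𝓘(j⁻¹ W)` is extended from its contraction `(j_*𝓘 ∩ 𝒪_{X'})(W)`.
* `comap_map_pullback_fst_fromSpecStalk` — **`j⁻¹(j_* 𝓘 ∩ 𝒪_{X'}) 𝒪_{S'} = 𝓘`** for every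
  ideal sheaf `𝓘` on `S' = X' ×_X Spec 𝒪_{X,x}` (`j` quasi-compact).
* `exists_idealSheaf_extension_fromSpecStalk` — **Temkin 2008, Lemma 2.1.1** for
  `S' = X' ×_X Spec 𝒪_{X,x}` (`j` quasi-compact — automatic from Mathlib's instances when `X`
  is locally Noetherian, `Spec 𝒪_{X,x}` being then a Noetherian scheme): every ideal sheaf `𝓘`
  on `S'` is `j⁻¹𝓙 𝒪_{S'}` for an ideal sheaf `𝓙` on `X'` whose support is the closure of
  `j(Supp 𝓘)`.

## Sources

* M. Temkin, *Desingularization of quasi-excellent schemes in characteristic zero*, Adv. Math.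
  219 (2008) 488–522 = arXiv:math/0703678, §2.1, Lemma 2.1.1 (p. 6); proof of Prop. 2.3.4
  (p. 12). [Temkin2008]
* A. Grothendieck, EGA I (1971) 6.9.7 / EGA IV₃ 8.6.3 (ideals on limits of schemes) — the
  references `[EGA I]`, `[EGA IV]` of Temkin's proof; not needed in this direct argument.
-/

noncomputable section

open CategoryTheory CategoryTheory.Limits AlgebraicGeometry TopologicalSpace

namespace Literature.AlgebraicGeometry.Resolution

universe u

/-! ## `Γ(Spec 𝒪_{X,x}, ⊤)` as a localization of `Γ(X, V)` -/

section SpecStalk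

variable {X : Scheme.{u}} (x : X)

/-- `Spec 𝒪_{X,x} ⟶ X` lands in every open neighbourhood of `x` (its image is the set of
generizations of `x`, Stacks 01J7). [cite: StacksProject, Tag 01J7] -/
theorem preimage_fromSpecStalk_eq_top (V : X.Opens) (hxV : x ∈ V) :
    (X.fromSpecStalk x) ⁻¹ᵁ V = ⊤ := by
  refine top_le_iff.mp fun s _ => ?_
  change X.fromSpecStalk x s ∈ V
  have hs : X.fromSpecStalk x s ⤳ x := Scheme.range_fromSpecStalk.le ⟨s, rfl⟩
  exact hs.mem_open V.2 hxV

/-- `⊤ ≤ (Spec 𝒪_{X,x} ⟶ X)⁻¹ V` for an open neighbourhood `V` of `x`. [folklore] -/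
theorem top_le_preimage_fromSpecStalk (V : X.Opens) (hxV : x ∈ V) :
    (⊤ : (Spec (X.presheaf.stalk x)).Opens) ≤ (X.fromSpecStalk x) ⁻¹ᵁ V :=
  (preimage_fromSpecStalk_eq_top x V hxV).ge

/-- On global sections, `Spec 𝒪_{X,x} ⟶ X` restricted over an open neighbourhood `V ∋ x` is the
germ map `Γ(X, V) ⟶ 𝒪_{X,x}` followed by `𝒪_{X,x} ≅ Γ(Spec 𝒪_{X,x}, ⊤)`. [folklore] -/
theorem appLE_fromSpecStalk_top (V : X.Opens) (hxV : x ∈ V) :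
    (X.fromSpecStalk x).appLE V ⊤ (top_le_preimage_fromSpecStalk x V hxV) =
      X.presheaf.germ V x hxV ≫ (Scheme.ΓSpecIso (X.presheaf.stalk x)).inv := by
  rw [Scheme.Hom.appLE, Scheme.fromSpecStalk_app hxV, Category.assoc, Category.assoc,
    ← Functor.map_comp]
  have : ((homOfLE (le_top : (X.fromSpecStalk x) ⁻¹ᵁ V ≤ ⊤)).op ≫
      (homOfLE (top_le_preimage_fromSpecStalk x V hxV)).op) = 𝟙 _ := Subsingleton.elim _ _
  rw [this]
  simp

/-- For an affine open neighbourhood `V` of `x`, `Γ(Spec 𝒪_{X,x}, ⊤)` is the localization of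
`Γ(X, V)` at the prime of `x`, along `(Spec 𝒪_{X,x} ⟶ X)^♯ : Γ(X, V) ⟶ Γ(Spec 𝒪_{X,x}, ⊤)`.
[folklore] -/
theorem isLocalization_sections_Spec_stalk {V : X.Opens} (hV : IsAffineOpen V) (hxV : x ∈ V) :
    letI := ((X.fromSpecStalk x).appLE V ⊤ (top_le_preimage_fromSpecStalk x V hxV)).hom.toAlgebra
    IsLocalization.AtPrime Γ(Spec (X.presheaf.stalk x), ⊤) (hV.primeIdealOf ⟨x, hxV⟩).asIdeal := by
  letI i1 : Algebra Γ(X, V) (X.presheaf.stalk x) := (X.presheaf.germ V x hxV).hom.toAlgebra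
  have hloc : IsLocalization.AtPrime (X.presheaf.stalk x) (hV.primeIdealOf ⟨x, hxV⟩).asIdeal :=
    hV.isLocalization_stalk ⟨x, hxV⟩
  letI i2 : Algebra Γ(X, V) Γ(Spec (X.presheaf.stalk x), ⊤) :=
    ((X.fromSpecStalk x).appLE V ⊤ (top_le_preimage_fromSpecStalk x V hxV)).hom.toAlgebra
  let e₀ : X.presheaf.stalk x ≃+* Γ(Spec (X.presheaf.stalk x), ⊤) :=
    (Scheme.ΓSpecIso (X.presheaf.stalk x)).symm.commRingCatIsoToRingEquiv
  let e : X.presheaf.stalk x ≃ₐ[Γ(X, V)] Γ(Spec (X.presheaf.stalk x), ⊤) :=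
    AlgEquiv.ofRingEquiv (f := e₀) fun r => by
      change e₀ ((X.presheaf.germ V x hxV) r) =
        ((X.fromSpecStalk x).appLE V ⊤ (top_le_preimage_fromSpecStalk x V hxV)) r
      rw [appLE_fromSpecStalk_top x V hxV]
      rfl
  exact IsLocalization.isLocalization_of_algEquiv (hV.primeIdealOf ⟨x, hxV⟩).asIdeal.primeCompl e

end SpecStalk

/-! ## Affine charts of `X' ×_X Spec 𝒪_{X,x}` are localizations of affine charts of `X'` -/

section ProOpen

variable {X' X : Scheme.{u}} (π : X' ⟶ X) (x : X)

/-- Every point of `S' = X' ×_X Spec 𝒪_{X,x}` maps into `π⁻¹(V)` for any open neighbourhood `V`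
of `x`. [folklore] -/
theorem pullback_fst_mem_preimage (V : X.Opens) (hxV : x ∈ V)
    (s : ↑(pullback π (X.fromSpecStalk x))) : pullback.fst π (X.fromSpecStalk x) s ∈ π ⁻¹ᵁ V := by
  change π (pullback.fst π (X.fromSpecStalk x) s) ∈ V
  rw [← Scheme.Hom.comp_apply, pullback.condition, Scheme.Hom.comp_apply]
  have : X.fromSpecStalk x (pullback.snd π (X.fromSpecStalk x) s) ⤳ x :=
    Scheme.range_fromSpecStalk.le ⟨_, rfl⟩
  exact this.mem_open V.2 hxV

/-- For an affine open `W ⊆ π⁻¹(V)` of `X'` (`V` an affine open neighbourhood of `x`), the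
preimage `j⁻¹(W) ⊆ S' = X' ×_X Spec 𝒪_{X,x}` is affine: it is `W ×_V Spec 𝒪_{X,x}`.
[folklore] -/
theorem isAffineOpen_preimage_pullback_fst {V : X.Opens} (hV : IsAffineOpen V) (hxV : x ∈ V)
    (W : X'.affineOpens) (hW : (W : X'.Opens) ≤ π ⁻¹ᵁ V) :
    IsAffineOpen ((pullback.fst π (X.fromSpecStalk x)) ⁻¹ᵁ (W : X'.Opens)) := by
  have H := IsPullback.of_hasPullback π (X.fromSpecStalk x)
  have hUY : (pullback.fst π (X.fromSpecStalk x)) ⁻¹ᵁ (W : X'.Opens) =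
      (pullback.fst π (X.fromSpecStalk x)) ⁻¹ᵁ (W : X'.Opens) ⊓
        (pullback.snd π (X.fromSpecStalk x)) ⁻¹ᵁ ⊤ := by simp
  haveI : IsAffine (V : Scheme.{u}) := hV
  haveI : IsAffine ((W : X'.Opens) : Scheme.{u}) := W.2
  haveI : IsAffine ((⊤ : (Spec (X.presheaf.stalk x)).Opens) : Scheme.{u}) := isAffineOpen_top _
  exact .of_isIso (Scheme.Hom.isPullback_resLE H (top_le_preimage_fromSpecStalk x V hxV)
    hW hUY).isoPullback.hom

/-- **Every ideal on the pro-open pro-subscheme is extended from `X'`, chart by chart**: for an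
affine open `W ⊆ π⁻¹(V)` of `X'` and an ideal sheaf `𝓘` on `S' = X' ×_X Spec 𝒪_{X,x}`,
`𝓘(j⁻¹W) = (j_*𝓘 ∩ 𝒪_{X'})(W) · Γ(S', j⁻¹W)`. Indeed `Γ(S', j⁻¹ W) = Γ(X', W) ⊗_{Γ(X,V)} 𝒪_{X,x}`
(sections of a fibre product of affine opens form a pushout square) is the localization of
`Γ(X', W)` at the image of `Γ(X, V) ∖ 𝔭_x`, and every ideal of a localization is the extension
of its contraction. [cite: Temkin2008, Lemma 2.1.1] -/
theorem ideal_preimage_le_comap_map_pullback_fst {V : X.Opens} (hV : IsAffineOpen V)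
    (hxV : x ∈ V) (W : X'.affineOpens) (hW : (W : X'.Opens) ≤ π ⁻¹ᵁ V)
    [QuasiCompact (pullback.fst π (X.fromSpecStalk x))]
    (I : (pullback π (X.fromSpecStalk x)).IdealSheafData) :
    I.ideal ⟨_, isAffineOpen_preimage_pullback_fst π x hV hxV W hW⟩ ≤
      ((I.map (pullback.fst π (X.fromSpecStalk x))).comap (pullback.fst π (X.fromSpecStalk x))).ideal
        ⟨_, isAffineOpen_preimage_pullback_fst π x hV hxV W hW⟩ := by
  -- notation
  set j := pullback.fst π (X.fromSpecStalk x) with hj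
  set g := pullback.snd π (X.fromSpecStalk x) with hg
  have H : IsPullback j g π (X.fromSpecStalk x) := IsPullback.of_hasPullback π (X.fromSpecStalk x)
  have hιV := top_le_preimage_fromSpecStalk x V hxV
  have hW₀ : IsAffineOpen (j ⁻¹ᵁ (W : X'.Opens)) := isAffineOpen_preimage_pullback_fst π x hV hxV W hW
  have hUY : j ⁻¹ᵁ (W : X'.Opens) = j ⁻¹ᵁ (W : X'.Opens) ⊓ g ⁻¹ᵁ ⊤ := by simp
  -- the four ring maps of the square of sections, as algebras
  have hgW : j ⁻¹ᵁ (W : X'.Opens) ≤ g ⁻¹ᵁ ⊤ := by simp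
  have hsq : π.appLE V W hW ≫ j.appLE (W : X'.Opens) (j ⁻¹ᵁ (W : X'.Opens)) le_rfl =
      (X.fromSpecStalk x).appLE V ⊤ hιV ≫ g.appLE ⊤ (j ⁻¹ᵁ (W : X'.Opens)) hgW := by
    simp only [Scheme.Hom.appLE_comp_appLE, H.w]
  algebraize [(π.appLE V W hW).hom, ((X.fromSpecStalk x).appLE V ⊤ hιV).hom,
    (j.appLE (W : X'.Opens) (j ⁻¹ᵁ (W : X'.Opens)) le_rfl).hom,
    (g.appLE ⊤ (j ⁻¹ᵁ (W : X'.Opens)) hgW).hom,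
    (j.appLE (W : X'.Opens) (j ⁻¹ᵁ (W : X'.Opens)) le_rfl).hom.comp (π.appLE V W hW).hom]
  haveI : IsScalarTower Γ(X, V) Γ(Spec (X.presheaf.stalk x), ⊤)
      Γ(pullback π (X.fromSpecStalk x), j ⁻¹ᵁ (W : X'.Opens)) :=
    IsScalarTower.of_algebraMap_eq' (by
      change (j.appLE (W : X'.Opens) (j ⁻¹ᵁ (W : X'.Opens)) le_rfl).hom.comp (π.appLE V W hW).hom =
        (g.appLE ⊤ (j ⁻¹ᵁ (W : X'.Opens)) hgW).hom.comp ((X.fromSpecStalk x).appLE V ⊤ hιV).hom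
      exact congrArg CommRingCat.Hom.hom hsq)
  -- `Γ(Spec 𝒪_{X,x}, ⊤)` is the localization of `Γ(X, V)` at `x`
  haveI hlocA : IsLocalization.AtPrime Γ(Spec (X.presheaf.stalk x), ⊤)
      (hV.primeIdealOf ⟨x, hxV⟩).asIdeal :=
    isLocalization_sections_Spec_stalk x hV hxV
  -- the square of sections is a pushout
  have hpush : IsPushout (π.appLE V W hW) ((X.fromSpecStalk x).appLE V ⊤ hιV)
      (j.appLE (W : X'.Opens) (j ⁻¹ᵁ (W : X'.Opens)) le_rfl)
      (g.appLE ⊤ (j ⁻¹ᵁ (W : X'.Opens)) hgW) :=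
    (isIso_pushoutSection_iff H hιV hW hUY).mp
      (isIso_pushoutSection_of_isAffineOpen H hιV hW hUY hV (isAffineOpen_top _) W.2)
  have hpush' : Algebra.IsPushout Γ(X, V) Γ(X', W) Γ(Spec (X.presheaf.stalk x), ⊤)
      Γ(pullback π (X.fromSpecStalk x), j ⁻¹ᵁ (W : X'.Opens)) := by
    rw [← CommRingCat.isPushout_iff_isPushout]
    exact hpush
  -- hence `Γ(S', j⁻¹ W)` is a localization of `Γ(X', W)`
  have hlocB : IsLocalization
      (Algebra.algebraMapSubmonoid Γ(X', W) (hV.primeIdealOf ⟨x, hxV⟩).asIdeal.primeCompl)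
      Γ(pullback π (X.fromSpecStalk x), j ⁻¹ᵁ (W : X'.Opens)) :=
    (Algebra.isLocalization_iff_isPushout ((hV.primeIdealOf ⟨x, hxV⟩).asIdeal.primeCompl)
      Γ(Spec (X.presheaf.stalk x), ⊤)).mpr hpush'
  -- compute the right-hand side on the chart
  have hmap : (I.map j).ideal W = (I.ideal ⟨_, hW₀⟩).comap (j.app (W : X'.Opens)).hom :=
    Scheme.IdealSheafData.ideal_map I j W hW₀
  rw [ideal_comap_of_le j (I.map j) W ⟨_, hW₀⟩ le_rfl, hmap, Scheme.Hom.app_eq_appLE]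
  -- every ideal of a localization is extended from its contraction
  intro b hb
  have key := IsLocalization.map_under
    (Algebra.algebraMapSubmonoid Γ(X', W) (hV.primeIdealOf ⟨x, hxV⟩).asIdeal.primeCompl)
    (S := Γ(pullback π (X.fromSpecStalk x), j ⁻¹ᵁ (W : X'.Opens))) (I.ideal ⟨_, hW₀⟩)
  rw [← key] at hb
  exact hb

/-! ## Temkin's Lemma 2.1.1 for `X' ×_X Spec 𝒪_{X,x}` -/

/-- **Every ideal sheaf on the pro-open pro-subscheme `S' = X' ×_X Spec 𝒪_{X,x}` is extended from
`X'`**: `j⁻¹(j_*𝓘 ∩ 𝒪_{X'}) · 𝒪_{S'} = 𝓘` (the first claim of Temkin 2008, Lemma 2.1.1, with the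
largest extension `j_*𝓘 ∩ 𝒪_{X'}` = Mathlib's `IdealSheafData.map`). Checked on the affine cover
of `S'` by the `j⁻¹(W)`, `W ⊆ π⁻¹(V)` affine (`ideal_preimage_le_comap_map_pullback_fst`).
[cite: Temkin2008, Lemma 2.1.1] -/
theorem comap_map_pullback_fst_fromSpecStalk [QuasiCompact (pullback.fst π (X.fromSpecStalk x))]
    (I : (pullback π (X.fromSpecStalk x)).IdealSheafData) :
    (I.map (pullback.fst π (X.fromSpecStalk x))).comap (pullback.fst π (X.fromSpecStalk x)) = I := by
  refine le_antisymm (Scheme.IdealSheafData.comap_map_le I _) ?_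
  obtain ⟨V, hV, hxV, -⟩ :=
    exists_isAffineOpen_mem_and_subset (X := X) (x := x) (U := ⊤) trivial
  let U : {W : X'.affineOpens // (W : X'.Opens) ≤ π ⁻¹ᵁ V} →
      (pullback π (X.fromSpecStalk x)).affineOpens :=
    fun W => ⟨_, isAffineOpen_preimage_pullback_fst π x hV hxV W.1 W.2⟩
  have hU : ⨆ i, (U i : (pullback π (X.fromSpecStalk x)).Opens) = ⊤ := by
    refine top_le_iff.mp fun s _ => ?_
    have hs := pullback_fst_mem_preimage π x V hxV s
    obtain ⟨W, hW, hsW, hWV⟩ := exists_isAffineOpen_mem_and_subset (X := X')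
      (x := pullback.fst π (X.fromSpecStalk x) s) (U := π ⁻¹ᵁ V) hs
    exact Opens.mem_iSup.mpr ⟨⟨⟨W, hW⟩, hWV⟩, hsW⟩
  exact Scheme.IdealSheafData.le_of_iSup_eq_top U hU fun W =>
    ideal_preimage_le_comap_map_pullback_fst π x hV hxV W.1 W.2 I

/-- **Temkin 2008, Lemma 2.1.1** ("Let `Z_S` denote the support of `𝓘_S` and `Z` be its Zariski
closure in `X`. Then there exists an ideal `𝓘 ⊂ 𝒪_X` such that `𝓘|_S = 𝓘_S` and the support
of `𝓘` is `Z`") for the pro-open pro-subscheme `S' = X' ×_X Spec 𝒪_{X,x}` of `X'` (`j`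
quasi-compact, e.g. `X` locally Noetherian): every ideal sheaf `𝓘` on `S'` is the inverse image
of an ideal sheaf `𝓙` on `X'` whose support is the closure of `j(Supp 𝓘)` — namely
`𝓙 = j_*𝓘 ∩ 𝒪_{X'}`. [cite: Temkin2008, Lemma 2.1.1] -/
theorem exists_idealSheaf_extension_fromSpecStalk
    [QuasiCompact (pullback.fst π (X.fromSpecStalk x))]
    (I : (pullback π (X.fromSpecStalk x)).IdealSheafData) :
    ∃ J : X'.IdealSheafData, J.comap (pullback.fst π (X.fromSpecStalk x)) = I ∧
      (J.support : Set X') = closure (pullback.fst π (X.fromSpecStalk x) '' I.support) :=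
  ⟨I.map _, comap_map_pullback_fst_fromSpecStalk π x I, by
    rw [Scheme.IdealSheafData.support_map]; rfl⟩

end ProOpen

end Literature.AlgebraicGeometry.Resolution

end
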